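import Summits.HodgeConjecture.CorCM.GaloisThirtyTwoOrderEightBranch
import Summits.HodgeConjecture.CorCM.GaloisThirtyTwoStructOfPowFour
import HarnessLib

/-!
# Degree `32`, all involutions central: the `2`-power classification holds outside one exponent-`4` residue

COR-CM (cell `pub-hodgecm2`), binder seat b04 (gen 36), count-neutral own lane «Galois-CM-type classification».  KERNEL ONLY:
theorems; no definition, no named fact, no `sorry`.  `HC_CM` is neither used nor claimed.  CAPSTONE of the gen-36 files of the
ORDER-`32` BASE programme (A7-JUNCTION gen-36 addendum).

**THEOREM (`struct_of_involutions_central`).**  Let `K` be a GOOD Galois CM field of degree `32` (every primitive CM type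
nondegenerate) all of whose Galois involutions are central (`Ω₁(Gal) ≤ Z(Gal)`).  Suppose `Gal(K/ℚ)` is not in the RESIDUAL
CONFIGURATION: a central involution `t ∉ {1, c}` which is a square, with every square in `V = {1, c, t, ct}` and every involution in
`V` (the groups of order `32`, exponent `4`, with exactly three involutions: `Q₈ × C₄`, `C₄ ⋊ Q₈` and census row #29 — all BAD by the
rows of `CorCM/GaloisCyclicFourCompositum` and `CorCM/GaloisThirtyTwoCensusClassTwoDegenerate`, but not yet recognised from these
abstract data).  Then STRUCT: `Gal(K/ℚ) = H·E`, `E` central of exponent `2` and order `≤ 2`, `c ∈ H ∖ E`, `H` cyclic or generalised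
quaternion — i.e. `Gal ∈ {C₃₂, Q₃₂, C₁₆ × C₂ (c ∈ C₁₆), Q₁₆ × C₂ (c ∈ Q₁₆)}`, the base case `n₀ = 5` of
`CorCM/GaloisTwoPowerClassification.struct_of_base` for these fields.

ASSEMBLY.  Abelian: `struct_of_comm_thirtytwo`.  (H2): `struct_of_pow_four_sq_thirtytwo`.  Otherwise `t = y² ∉ {1, c}` is a central
involution and the CM quotient `K^⟨t⟩` is GOOD of degree `16` (`CorCM/GaloisThirtyTwoQuotientSixteen`): its second GOOD16 alternative is
`struct_of_order_eight_pullback` (`CorCM/GaloisThirtyTwoOrderEightBranch`); its first puts all squares in `V`, and then every involution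
lies in `V` (a further central involution `s` would give, through `K^⟨s⟩`, `y² ∈ {1, c, s, cs}`) — the residual configuration.

## References

* [Shimura1998] G. Shimura, *Abelian Varieties with Complex Multiplication and Modular Functions*, §6.2 Thm. 3, §8.2 Prop. 26.
* [Kubota1965] T. Kubota, *On the field extension by complex multiplication*, Trans. AMS 118 (1965), §2 and §4 Lemma 2.
* [Rotman1995] J. J. Rotman, *An Introduction to the Theory of Groups*, 4th ed., GTM 148, Thm. 5.46.
* [Dodson1984] B. Dodson, *The structure of Galois groups of CM-fields*, Trans. AMS 283 (1984), §3.3, §5.2.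
-/

noncomputable section

open CategoryTheory CategoryTheory.Limits NumberField
open scoped BigOperators

namespace Summit.HodgeConjecture.CorCM.GaloisModels

open Literature.NumberTheory.ComplexMultiplication
open Literature.AlgebraicGeometry.Motives (AbelianVariety CMType)
open Literature.AlgebraicGeometry.HodgeTheory
open Literature.AlgebraicGeometry.Pohlmann1968
open Summit.HodgeConjecture.CorCM.GaloisRank

section Field

variable {K : Type} [Field K] [NumberField K] [IsCMField K] [IsGalois ℚ K]

/-- **GOOD Galois CM fields of degree `32` with all involutions central are structured — outside the exponent-`4` residue.**
`K` Galois CM of degree `32`, every primitive CM type nondegenerate, every involution of `Gal(K/ℚ)` central, and NOT: some central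
involution `t ∉ {1, c}` is a square while all squares and all involutions lie in `{1, c, t, ct}`.  Then `Gal(K/ℚ) = H·E` with `E`
central of exponent `2`, `|E| ≤ 2`, `c ∈ H ∖ E`, `H` cyclic or generalised quaternion.
[cite: Shimura1998, §6.2 Thm. 3 and §8.2 Prop. 26] [cite: Kubota1965, §2 and §4 Lemma 2] [cite: Rotman1995, Thm. 5.46]
[cite: Dodson1984, §3.3 and §5.2] -/
theorem struct_of_involutions_central (hdeg : Module.finrank ℚ K = 32)
    (hgood : ∀ (Φ : CMType K) (φ : K →+* ℂ), IsPrimitive (ℂ ≃+* ℂ) Φ.1 φ → IsNondegenerate Φ)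
    (hinvc : ∀ s : K ≃ₐ[ℚ] K, s * s = 1 → ∀ g : K ≃ₐ[ℚ] K, g * s = s * g)
    (hres : ∀ t y : K ≃ₐ[ℚ] K, t * t = 1 → t ≠ 1 → t ≠ (IsCMField.complexConj K).restrictScalars ℚ → y * y = t →
      (∀ g : K ≃ₐ[ℚ] K, g * g = 1 ∨ g * g = (IsCMField.complexConj K).restrictScalars ℚ ∨ g * g = t ∨
        g * g = (IsCMField.complexConj K).restrictScalars ℚ * t) →
      (∀ s : K ≃ₐ[ℚ] K, s * s = 1 → s = 1 ∨ s = (IsCMField.complexConj K).restrictScalars ℚ ∨ s = t ∨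
        s = (IsCMField.complexConj K).restrictScalars ℚ * t) → False) :
    ∃ (H E : Subgroup (K ≃ₐ[ℚ] K)) (k : ℕ), H.IsComplement' E ∧ (IsCMField.complexConj K).restrictScalars ℚ ∈ H ∧
      (IsCMField.complexConj K).restrictScalars ℚ ∉ E ∧ (∀ e ∈ E, e * e = 1 ∧ ∀ g : K ≃ₐ[ℚ] K, g * e = e * g) ∧
      Nat.card E ≤ 2 ∧ Nat.card H = 2 ^ k ∧ (IsCyclic H ∨ (3 ≤ k ∧ Nonempty (H ≃* QuaternionGroup (2 ^ (k - 2))))) := by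
  classical
  set c := (IsCMField.complexConj K).restrictScalars ℚ with hcdef
  have hcc : c * c = 1 := model_complexConj_mul_self (MulEquiv.refl (K ≃ₐ[ℚ] K)) (by simp [hcdef])
  have hc1 : c ≠ 1 := model_complexConj_ne_one (MulEquiv.refl (K ≃ₐ[ℚ] K)) (by simp [hcdef])
  have hccen : ∀ g : K ≃ₐ[ℚ] K, g * c = c * g := fun g =>
    (model_complexConj_comm (MulEquiv.refl (K ≃ₐ[ℚ] K)) (by simp [hcdef]) g).symm
  by_cases hab : ∀ g h : K ≃ₐ[ℚ] K, g * h = h * g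
  · exact struct_of_comm_thirtytwo hdeg hgood hab
  by_cases hH2 : ∀ y : K ≃ₐ[ℚ] K, y ^ 4 = 1 → y * y = 1 ∨ y * y = c
  · exact struct_of_pow_four_sq_thirtytwo hdeg hgood hinvc hH2
  push Not at hab hH2
  obtain ⟨g₀, h₀, hgh⟩ := hab
  obtain ⟨y, hy4, hy1, hyc⟩ := hH2
  set t := y * y with htdef
  have htt : t * t = 1 := by
    rw [htdef, show y * y * (y * y) = y ^ 4 by simp only [pow_succ, pow_zero, one_mul, mul_assoc]]; exact hy4
  have htcen : ∀ g : K ≃ₐ[ℚ] K, g * t = t * g := hinvc t htt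
  rcases sq_mem_or_exists_order_eight_of_central_involution hdeg hgood t htt hy1 hyc htcen with hV | ⟨r, hr, hr4, hconj⟩
  · /- first alternative: all squares in `V = {1, c, t, ct}`; then all involutions lie in `V` — the residual configuration -/
    exfalso
    refine hres t y htt hy1 hyc rfl hV fun s hss => ?_
    by_contra hsV
    push Not at hsV
    obtain ⟨hs1, hsc, hst, hsct⟩ := hsV
    have hscen : ∀ g : K ≃ₐ[ℚ] K, g * s = s * g := hinvc s hss
    rcases sq_mem_or_exists_order_eight_of_central_involution hdeg hgood s hss hs1 hsc hscen with hW | ⟨r, hr, -, -⟩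
    · -- `t = y² ∈ {1, c, s, cs}` forces `s ∈ {t, ct}`
      rcases hW y with h | h | h | h
      · exact hy1 h
      · exact hyc h
      · exact hst h.symm
      · apply hsct
        -- `t = c s` ⟹ `s = c t`
        calc s = c * (c * s) := by rw [← mul_assoc, hcc, one_mul]
          _ = c * t := by rw [← h]
    · -- an element of order `8` is impossible when every square lies in `V`
      have hr4 : r ^ 4 = 1 := by
        rw [show r ^ 4 = (r * r) * (r * r) by simp only [pow_succ, pow_zero, one_mul, mul_assoc]]
        rcases hV r with h | h | h | h <;> rw [h]
        · exact mul_one 1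
        · exact hcc
        · exact htt
        · calc c * t * (c * t) = c * (t * c) * t := by simp only [mul_assoc]
            _ = c * (c * t) * t := by rw [hccen t]
            _ = (c * c) * (t * t) := by simp only [mul_assoc]
            _ = 1 := by rw [hcc, htt, one_mul]
      have := orderOf_dvd_of_pow_eq_one hr4
      rw [hr] at this
      omega
  · /- second alternative: the «element of order `8`» branch -/
    exact struct_of_order_eight_pullback hdeg hgood hinvc t htt hy1 hyc r hr hr4 hconj ⟨g₀, h₀, hgh⟩

end Field

end Summit.HodgeConjecture.CorCM.GaloisModels

end
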